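import Summits.Ventures.CertifiedArithmetic.LowPrec.SRPythagorasNested
import HarnessLib

/-!
# Stochastic rounding in low-precision formats XCVI — the reflection `c ↦ −c`: StochasticA outcome
# trees of a symmetric value set are mirror-symmetric; the Pythagorean law on NEGATIVE windows

HONEST FRAMING: certified error envelopes and provably optimal rounding/accumulation schemes for
low-precision formats under stated cost models; every table by two implementations; no hardware or
vendor claims.

XCIV (`SRPythagorasNested`) proved, on ONE-SIGNED nested windows `0 ≤ lo` with `N ≥ J` random bits, that
IEEE P3109 StochasticA trees are drift-antitone and obey `E(ŝₙ − sₙ)² ≤ n·G²/4 + (n·2^{-N}·G)²` for every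
`n`.  Here, over any ordered field and for value sets `F` that are SYMMETRIC (`a ∈ F → −a ∈ F`) and
contain `0` (every binary format): StochasticA is applied sign-magnitude (`pUpQ` perturbs the probability
of moving AWAY from zero), so `⌊−c⌋_F = −⌈c⌉_F`, `θ_q(−c) = 1 − θ_q(c)` on nondegenerate cells
(`pUpQ_neg`), one step reflects (`stepQ_neg`: `E f(SR_q(−c)) = E f(−SR_q c)`), and the whole outcome
tree of the negated data from `−s` is the mirror image of the tree from `s` (`accExpQ_neg`; also
`noSat_neg`, `inWindow_neg`, `driftAntitone_of_neg`).  Consequently XCIV transfers verbatim to NEGATIVE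
windows `hi ≤ 0` whose mirror image `[−hi, −lo]` is nested (`NestedWindow.stochasticA_mirror`:
drift-antitone AND the law, `G = 2^J·g`, bits `N ≥ J` = binade span of the window).  File XCVII treats
windows ACROSS zero; XCVIII instantiates both for every `Format`.
Scope (honest): no saturation; exact expectations over the outcome tree; nothing for fewer than `J` bits.
Prior art: [ElararEtAl2025, Thm. 3–4]; [ConnollyHighamMary2021, Lemma 4.4]; IEEE P3109 (sign-magnitude
application of the stochastic modes).  No Mathlib precedent.
-/

namespace Summit.Ventures.CertifiedArithmetic.LowPrec.SR

open Literature.ComputerArithmetic.ConnollyHighamMary2021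
open Finset

variable {K : Type*} [Field K] [LinearOrder K] [IsStrictOrderedRing K] [FloorRing K]

namespace LimitedBits

/-! ### Reflection `c ↦ −c` in a symmetric value set containing `0` -/

section Reflect

variable {F : Finset K}

omit [FloorRing K] in
/-- The hull of a symmetric value set is symmetric. -/
theorem inHull_neg (hF : ∀ a ∈ F, -a ∈ F) {c : K} (hc : InHull F c) : InHull F (-c) := by
  obtain ⟨⟨y, hy, hyc⟩, ⟨z, hz, hcz⟩⟩ := hc
  exact ⟨⟨-z, hF z hz, neg_le_neg hcz⟩, ⟨-y, hF y hy, neg_le_neg hyc⟩⟩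

omit [FloorRing K] in
/-- Lower candidate of `−c` = minus the upper candidate of `c`. -/
theorem dn_neg (hF : ∀ a ∈ F, -a ∈ F) {c : K} (hc : InHull F c) : dn F (-c) = -up F c := by
  have hc' : InHull F (-c) := inHull_neg hF hc
  unfold dn up
  rw [clamp_eq_self hc, clamp_eq_self hc']
  have huF : roundUp F c ∈ F := roundUp_mem hc.2
  have h1 : -roundUp F c ≤ roundDown F (-c) :=
    le_roundDown_of_mem (hF _ huF) (neg_le_neg (le_roundUp F c))
  have hdF : roundDown F (-c) ∈ F :=
    roundDown_mem ⟨-roundUp F c, hF _ huF, neg_le_neg (le_roundUp F c)⟩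
  have h2 : roundUp F c ≤ -roundDown F (-c) :=
    roundUp_le_of_mem (hF _ hdF) (by linarith [roundDown_le F (-c)])
  linarith

omit [FloorRing K] in
/-- Upper candidate of `−c` = minus the lower candidate of `c`. -/
theorem up_neg (hF : ∀ a ∈ F, -a ∈ F) {c : K} (hc : InHull F c) : up F (-c) = -dn F c := by
  have hc' : InHull F (-c) := inHull_neg hF hc
  have h := dn_neg hF hc'
  rw [neg_neg] at h
  linarith

omit [FloorRing K] [IsStrictOrderedRing K] in
/-- The exact up-probability at a hull point, in terms of its candidates. -/
theorem pUp_eq {c : K} (hc : InHull F c) : pUp F c = (c - dn F c) / (up F c - dn F c) := by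
  unfold pUp probUp dn up; rw [clamp_eq_self hc]

omit [FloorRing K] in
/-- Reflection of the exact up-probability on a nondegenerate cell: `θ(−c) = 1 − θ(c)`. -/
theorem pUp_neg (hF : ∀ a ∈ F, -a ∈ F) {c : K} (hc : InHull F c) (hne : up F c ≠ dn F c) :
    pUp F (-c) = 1 - pUp F c := by
  have hc' : InHull F (-c) := inHull_neg hF hc
  have hw : up F c - dn F c ≠ 0 := sub_ne_zero.mpr hne
  rw [pUp_eq hc', pUp_eq hc, dn_neg hF hc, up_neg hF hc, show -dn F c - -up F c = up F c - dn F c by ring,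
    show -c - -up F c = up F c - c by ring, eq_sub_iff_add_eq, ← add_div,
    show up F c - c + (c - dn F c) = up F c - dn F c by ring, div_self hw]

omit [FloorRing K] in
/-- **Sign-magnitude symmetry of the perturbed step**: on a nondegenerate cell of a symmetric value set
containing `0`, the up-probability at `−c` is the down-probability at `c`. -/
theorem pUpQ_neg (hF : ∀ a ∈ F, -a ∈ F) (h0F : (0 : K) ∈ F) (q : K → K) {c : K} (hc : InHull F c)
    (hne : up F c ≠ dn F c) : pUpQ F q (-c) = 1 - pUpQ F q c := by
  unfold pUpQ
  rw [dn_neg hF hc, pUp_neg hF hc hne]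
  by_cases hd : 0 ≤ dn F c
  · have hu : 0 < up F c := lt_of_le_of_lt hd (lt_of_le_of_ne (dn_le_up F c) (Ne.symm hne))
    rw [if_pos hd, if_neg (by linarith), sub_sub_cancel]
  · have hc0 : c < 0 := by
      by_contra h
      exact hd ((le_dn_of_mem h0F (not_lt.mp h)))
    have hu : up F c ≤ 0 := up_le_of_mem h0F hc0.le
    rw [if_neg hd, if_pos (by linarith)]
    ring

omit [FloorRing K] in
/-- **Reflection of one step**: `E f(SR_q(−c)) = E f(−SR_q(c))`. -/
theorem stepQ_neg (hF : ∀ a ∈ F, -a ∈ F) (h0F : (0 : K) ∈ F) (q : K → K) {c : K} (hc : InHull F c)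
    (f : K → K) : stepQ F q (-c) f = stepQ F q c (fun t => f (-t)) := by
  unfold stepQ
  rw [up_neg hF hc, dn_neg hF hc]
  by_cases hne : up F c = dn F c
  · rw [hne]; ring
  · rw [pUpQ_neg hF h0F q hc hne]; ring

omit [FloorRing K] in
/-- The step mean is odd: `E[SR_q(−c)] = −E[SR_q(c)]`. -/
theorem stepQ_id_neg (hF : ∀ a ∈ F, -a ∈ F) (h0F : (0 : K) ∈ F) (q : K → K) {c : K}
    (hc : InHull F c) : stepQ F q (-c) (fun t => t) = -stepQ F q c (fun t => t) := by
  rw [stepQ_neg hF h0F q hc]; unfold stepQ; ring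

omit [FloorRing K] in
/-- **Reflection of the outcome tree**: `E f(ŝₙ)` for the negated data from `−s` equals `E f(−ŝₙ)` for
the original data from `s` (no saturation). -/
theorem accExpQ_neg (hF : ∀ a ∈ F, -a ∈ F) (h0F : (0 : K) ∈ F) (q : K → K) :
    ∀ (x : ℕ → K) (n : ℕ) (f : K → K) (s : K), NoSat F x n s →
      accExpQ F q (fun i => -x i) n f (-s) = accExpQ F q x n (fun t => f (-t)) s := by
  intro x n
  induction n generalizing x with
  | zero => intro f s _; rfl
  | succ n ih =>
    rintro f s ⟨hin, hnu, hnd⟩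
    show stepQ F q (-s + -x 0) (accExpQ F q (fun i => -x (i + 1)) n f)
      = stepQ F q (s + x 0) (accExpQ F q (fun i => x (i + 1)) n (fun t => f (-t)))
    rw [show -s + -x 0 = -(s + x 0) by ring, stepQ_neg hF h0F q hin]
    unfold stepQ
    dsimp only
    rw [ih (fun i => x (i + 1)) f (up F (s + x 0)) hnu, ih (fun i => x (i + 1)) f (dn F (s + x 0)) hnd]

omit [FloorRing K] [IsStrictOrderedRing K] in
/-- `E[−ŝₙ] = −E[ŝₙ]`. -/
theorem accExpQ_negId (q : K → K) (x : ℕ → K) (n : ℕ) (s : K) :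
    accExpQ F q x n (fun t => -t) s = -accExpQ F q x n (fun t => t) s := by
  have e : (fun t : K => -t) = fun t => (-1) * t + 0 * t := funext fun t => by ring
  rw [e, accExpQ_lin]; ring

omit [FloorRing K] in
/-- No saturation is reflection-invariant. -/
theorem noSat_neg (hF : ∀ a ∈ F, -a ∈ F) :
    ∀ (x : ℕ → K) (n : ℕ) (s : K), NoSat F x n s → NoSat F (fun i => -x i) n (-s) := by
  intro x n
  induction n generalizing x with
  | zero => intro s _; trivial
  | succ n ih =>
    rintro s ⟨hin, hnu, hnd⟩
    have e : -s + -x 0 = -(s + x 0) := by ring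
    refine ⟨?_, ?_, ?_⟩
    · rw [e]; exact inHull_neg hF hin
    · show NoSat F (fun i => -x (i + 1)) n (up F (-s + -x 0))
      rw [e, up_neg hF hin]; exact ih _ _ hnd
    · show NoSat F (fun i => -x (i + 1)) n (dn F (-s + -x 0))
      rw [e, dn_neg hF hin]; exact ih _ _ hnu

omit [FloorRing K] in
/-- A tree confined to `[lo, hi]` reflects to a tree confined to `[−hi, −lo]`. -/
theorem inWindow_neg (hF : ∀ a ∈ F, -a ∈ F) {lo hi : K} :
    ∀ (x : ℕ → K) (n : ℕ) (s : K), NoSat F x n s → InWindow F lo hi x n s →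
      InWindow F (-hi) (-lo) (fun i => -x i) n (-s) := by
  intro x n
  induction n generalizing x with
  | zero => intro s _ _; trivial
  | succ n ih =>
    rintro s ⟨hin, hnu, hnd⟩ ⟨⟨h1, h2⟩, hwu, hwd⟩
    have e : -s + -x 0 = -(s + x 0) := by ring
    have hin' : InHull F (-(s + x 0)) := inHull_neg hF hin
    rw [clamp_eq_self hin] at h1 h2
    refine ⟨?_, ?_, ?_⟩
    · rw [e, clamp_eq_self hin']; constructor <;> linarith
    · show InWindow F (-hi) (-lo) (fun i => -x (i + 1)) n (up F (-s + -x 0))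
      rw [e, up_neg hF hin]; exact ih _ _ hnd hwd
    · show InWindow F (-hi) (-lo) (fun i => -x (i + 1)) n (dn F (-s + -x 0))
      rw [e, dn_neg hF hin]; exact ih _ _ hnu hwu

omit [FloorRing K] in
/-- Drift-antitonicity is reflection-invariant: if the mirrored tree is drift-antitone, so is the tree. -/
theorem driftAntitone_of_neg (hF : ∀ a ∈ F, -a ∈ F) (h0F : (0 : K) ∈ F) (q : K → K) :
    ∀ (x : ℕ → K) (n : ℕ) (s : K), NoSat F x n s →
      DriftAntitone F q (fun i => -x i) n (-s) → DriftAntitone F q x n s := by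
  intro x n
  induction n generalizing x with
  | zero => intro s _ _; trivial
  | succ n ih =>
    rintro s ⟨hin, hnu, hnd⟩ ⟨hroot, hau, had⟩
    have e : -s + -x 0 = -(s + x 0) := by ring
    have hu' : up F (-s + -x 0) = -dn F (s + x 0) := by rw [e, up_neg hF hin]
    have hd' : dn F (-s + -x 0) = -up F (s + x 0) := by rw [e, dn_neg hF hin]
    refine ⟨?_, ?_, ?_⟩
    · have h := hroot
      simp only [] at h
      rw [hu', hd', accExpQ_neg hF h0F q _ n _ _ hnd, accExpQ_neg hF h0F q _ n _ _ hnu,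
        accExpQ_negId, accExpQ_negId] at h
      linarith
    · have h := had
      rw [hd'] at h
      exact ih _ _ hnu h
    · have h := hau
      rw [hu'] at h
      exact ih _ _ hnd h

/-- **Negative windows by mirror symmetry.**  If the mirror image `[−hi, −lo]` of the window is nested
(`hi ≤ 0`) and `N ≥ J`, every StochasticA tree confined to `[lo, hi]` (no saturation) is drift-antitone
and obeys `E(ŝₙ − sₙ)² ≤ n·G²/4 + (n·2^{-N}·G)²` with `G = 2^J·g`, for every `n`. -/
theorem NestedWindow.stochasticA_mirror (hF : ∀ a ∈ F, -a ∈ F) (h0F : (0 : K) ∈ F) {lo hi g : K}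
    {J : ℕ} (hW : NestedWindow F (-hi) (-lo) g J) (hhi : hi ≤ 0) {N : ℕ} (hJN : J ≤ N) (x : ℕ → K)
    (n : ℕ) (s : K) (hns : NoSat F x n s) (hw : InWindow F lo hi x n s) :
    DriftAntitone F (probAwayA N) x n s ∧
      accExpQ F (probAwayA N) x n (fun t => (t - (s + ∑ i ∈ range n, x i)) ^ 2) s
        ≤ n * ((2 ^ J * g) ^ 2 / 4) + (n * (1 / 2 ^ N * (2 ^ J * g))) ^ 2 := by
  have hns' := noSat_neg hF x n s hns
  have hw' := inWindow_neg hF x n s hns hw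
  refine ⟨driftAntitone_of_neg hF h0F _ x n s hns
    (hW.driftAntitone_stochasticA (by linarith) hJN _ n _ hns' hw'), ?_⟩
  have key := hW.stochasticA_acc_sq_le (by linarith) hJN (fun i => -x i) n (-s) hns' hw'
  rw [accExpQ_neg hF h0F _ x n _ s hns] at key
  have e : (fun t : K => (-t - (-s + ∑ i ∈ range n, -x i)) ^ 2)
      = fun t => (t - (s + ∑ i ∈ range n, x i)) ^ 2 := by
    funext t; rw [sum_neg_distrib]; ring
  rwa [e] at key

end Reflect

end LimitedBits

end Summit.Ventures.CertifiedArithmetic.LowPrec.SR
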